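import Summits.QuantumFields.YangMills.Theorems.UnitScaleTiltProp7CovariantComparisonPairings
import Summits.QuantumFields.YangMills.Theorems.UnitScaleTiltProp7LatticeVectorFlatTools
import HarnessLib

/-!
# Route `UnitScaleTilt`, crux K1 «MinimiserStabilityRegPr» (stmt-QuantumFields-19200), EX row (5) `h3` (STOREY H), H2 pipeline (ii) — programme **H2-LOC**, brick **(C2b, part 2):
# THE COVARIANT DIRICHLET COMPARISON** — at a box `Q_{r+1}(z)` where the unitary background `R` is `δ`-close to the identity, a solution `u` of the COVARIANT equation
# `L_R^κ u = D*_R g + src` splits as `u = h + w` with `h` FLAT `κ`-harmonic on `Q_{r+1}(z)`, `w = 0` off `Q_{r+1}(z)`, and the flat energy of `w` bounded by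
# `5dδ²N²·(covariant energy of u on Q_{r+2})` + `5(2r+5)^d·(4dm² + N²σ² + 5dδ²M_u²)`, `N = 2r+4` — the perturbation step of the Campanato road PRICED IN ENERGY
# (★CHAIR WORD №60 (2), ★★OWNER RULING №52).

Cell `ym3-torus` (HUMAN RULING D-0037; rung R3 = SU(2) YM₃ on T³ — NOT d = 4, NOT infinite volume, NOT a mass gap, NOT Clay).  Width seat `ym3-torus-px19` (gen 16);
`--supports stmt-QuantumFields-19200 --as helper`; count-neutral; THEOREMS ONLY (0 `def`, 0 `sorry`, default heartbeats).  Inputs BY NAME: (C2b part 1)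
✓`Prop7CovariantComparisonPairings` (`sum_inner_flatLop`, `flatLop_sub`, `pairing_datum_le`, `pairing_source_le`, `pairing_perturbation_le`, `sq_le_five`), (C1) ✓p780868
`Prop7CovariantLatticeCaccioppoli.sum_inner_covLop`, (C2a) ✓`Prop7LatticeVectorFlatTools` (`exists_dirichlet_W`, `poincare_zero_ext_W`, `sum_le_sum_of_vanish_off`).

WHAT IS PROVED (ns `Summit.QuantumFields.YangMills.Theorems.Prop7CovariantDirichletComparison`; `W` finite-dimensional real inner-product space, `d ≥ 1`).
* §1 `cov_energy_le_flat` (`ΣΣ‖D_Rw‖² ≤ 2ΣΣ‖w₊−w‖² + 2δ²ΣΣ‖w₊‖²`), `sum_translate_sq_le` (`ΣΣ‖w₊‖² ≤ d·Σ_{Q'}‖w‖²` for `w` vanishing off `Q'`), `flat_energy_identity`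
  (`Σ_{Q_{r+2}}⟪w, L^κ w⟫ = E + κΣ_{Q_{r+2}}‖w‖²` for `w` vanishing off `Q_{r+1}`).
* §2 ★★★ `covariant_dirichlet_comparison` — `κ > 0`, `r ≥ 0`, `N = 2r+4`, `L_R^κ u = D*_R g + src` on `Q_{r+1}(z)`, `‖u‖ ≤ M_u` on `Q_{r+3}(z)`, `‖g‖ ≤ m`, `‖src‖ ≤ σ`,
  `‖R(y,μ)x − x‖ ≤ δ‖x‖` on `Q_{r+2}(z)`, `dδ²N² ≤ 1` ⟹ `∃ h w`, `u = h + w`, `w = 0` off `Q_{r+1}(z)`, `L^κ h = 0` on `Q_{r+1}(z)`,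
  `Σ_{Q_{r+2}}Σ_μ‖w₊ − w‖² ≤ 5dδ²N²·Σ_{Q_{r+2}}Σ_μ‖D_Rμ u‖² + 5(2r+5)^d(4dm² + N²σ² + 5dδ²M_u²)`.
HYP-SAT (★★OWNER RULING №42): one equation, four sup rows on boxes, one explicit smallness inequality; inhabited by `u = g = src = 0`, `R ≡ 1`; at the member (C5) `δ = 2√2·48ε₀η`,
`r + 2 ≤ 3ℓ` ⇒ `dδ²N² ≤ 3·8·48²·49·ε₀²` — an `ε₀`-threshold (cap-type).  HONEST SCOPE: [folklore] ([Giaquinta1984] Ch. III §2 Thm 2.2, perturbation form); C3 (px21 g16), C4, C5, C6 NOT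
here; nothing of `hHlocV`, `hWsup`, H2, `h3`, norm_G, EX, 19200 or the rung is proved; the Yang–Mills mass gap is NOT proved.

References: T. Bałaban, CMP **99** (1985) 389–434 [Balaban1985BackgroundPropagators] ((3.23) p.394, (3.35) p.396, Thm 3.1 (3.43) p.398); CMP **96** (1984) 223–250
[Balaban1984PropagatorsII] ((1.9) p.226); M. Giaquinta, *Multiple integrals …* (1983) [Giaquinta1984] (Ch. III §2 Thm 2.2 pp.78–79).
-/

set_option autoImplicit false

noncomputable section

open scoped BigOperators InnerProductSpace
open Finset

namespace Summit.QuantumFields.YangMills.Theorems.Prop7CovariantDirichletComparison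

open Literature.MathematicalPhysics.QuantumFieldTheory.Balaban1983to89
open B4Eq19LatticeOperators (Zd unitVec box mem_box box_mono add_unitVec_mem_box card_box sum_box_add_right)
open Summit.QuantumFields.YangMills.Theorems.Prop7CovariantLatticeCaccioppoli (sum_inner_covLop)
open Summit.QuantumFields.YangMills.Theorems.Prop7LatticeVectorFlatTools (exists_dirichlet_W poincare_zero_ext_W sum_le_sum_of_vanish_off)
open Summit.QuantumFields.YangMills.Theorems.Prop7CovariantComparisonPairings (sum_inner_flatLop flatLop_sub pairing_datum_le pairing_source_le pairing_perturbation_le sq_le_five)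

variable {d : ℕ} {W : Type*} [NormedAddCommGroup W] [InnerProductSpace ℝ W]

/-! ## §1 Energy bookkeeping -/

/-- Covariant energy from flat energy: `ΣΣ‖Rw₊ − w‖² ≤ 2ΣΣ‖w₊ − w‖² + 2δ²ΣΣ‖w₊‖²` when `‖R(y,μ)x − x‖ ≤ δ‖x‖` on the box.
[folklore] [cite: Balaban1985BackgroundPropagators, (3.35) p.396] -/
theorem cov_energy_le_flat (R : Zd d → Fin d → (W ≃ₗᵢ[ℝ] W)) (w : Zd d → W) (Q : Finset (Zd d)) {δ : ℝ}
    (hR : ∀ y ∈ Q, ∀ (μ : Fin d) (x : W), ‖R y μ x - x‖ ≤ δ * ‖x‖) :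
    ∑ y ∈ Q, ∑ μ, ‖R y μ (w (y + unitVec μ)) - w y‖ ^ 2 ≤ 2 * ∑ y ∈ Q, ∑ μ, ‖w (y + unitVec μ) - w y‖ ^ 2 + 2 * (δ ^ 2 * ∑ y ∈ Q, ∑ μ, ‖w (y + unitVec μ)‖ ^ 2) := by
  rw [Finset.mul_sum, Finset.mul_sum, Finset.mul_sum, ← Finset.sum_add_distrib]
  refine Finset.sum_le_sum fun y hy => ?_
  rw [Finset.mul_sum, Finset.mul_sum, Finset.mul_sum, ← Finset.sum_add_distrib]
  refine Finset.sum_le_sum fun μ _ => ?_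
  have hp : ‖R y μ (w (y + unitVec μ)) - w (y + unitVec μ)‖ ≤ δ * ‖w (y + unitVec μ)‖ := hR y hy μ _
  have e : R y μ (w (y + unitVec μ)) - w y = (w (y + unitVec μ) - w y) + (R y μ (w (y + unitVec μ)) - w (y + unitVec μ)) := by abel
  have h2 : ‖R y μ (w (y + unitVec μ)) - w y‖ ≤ ‖w (y + unitVec μ) - w y‖ + δ * ‖w (y + unitVec μ)‖ := by
    rw [e]; exact (norm_add_le _ _).trans (add_le_add le_rfl hp)
  have h3 : 0 ≤ ‖w (y + unitVec μ) - w y‖ + δ * ‖w (y + unitVec μ)‖ := (norm_nonneg _).trans h2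
  have h4 := two_mul_le_add_sq ‖w (y + unitVec μ) - w y‖ (δ * ‖w (y + unitVec μ)‖)
  calc ‖R y μ (w (y + unitVec μ)) - w y‖ ^ 2 ≤ (‖w (y + unitVec μ) - w y‖ + δ * ‖w (y + unitVec μ)‖) ^ 2 := pow_le_pow_left₀ (norm_nonneg _) h2 2
    _ = ‖w (y + unitVec μ) - w y‖ ^ 2 + 2 * ‖w (y + unitVec μ) - w y‖ * (δ * ‖w (y + unitVec μ)‖) + (δ * ‖w (y + unitVec μ)‖) ^ 2 := by ring
    _ ≤ 2 * ‖w (y + unitVec μ) - w y‖ ^ 2 + 2 * (δ ^ 2 * ‖w (y + unitVec μ)‖ ^ 2) := by rw [mul_pow] at h4 ⊢; linarith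

omit [InnerProductSpace ℝ W] in
/-- Translates of a function supported in `Q'`: `Σ_{y∈Q}Σ_μ ‖w(y+e_μ)‖² ≤ d·Σ_{Q'} ‖w‖²`. [folklore] [cite: Giaquinta1984, Ch. III §1 p.64] -/
theorem sum_translate_sq_le [DecidableEq (Zd d)] (w : Zd d → W) (Q Q' : Finset (Zd d)) (hw : ∀ y ∉ Q', w y = 0) :
    ∑ y ∈ Q, ∑ μ, ‖w (y + unitVec μ)‖ ^ 2 ≤ d * ∑ y ∈ Q', ‖w y‖ ^ 2 := by
  rw [Finset.sum_comm]
  have h : ∀ μ : Fin d, ∑ y ∈ Q, ‖w (y + unitVec μ)‖ ^ 2 ≤ ∑ y ∈ Q', ‖w y‖ ^ 2 := by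
    intro μ
    have e : ∑ y ∈ Q, ‖w (y + unitVec μ)‖ ^ 2 = ∑ y ∈ Q.image (· + unitVec μ), ‖w y‖ ^ 2 := by
      rw [Finset.sum_image]; intro a _ b _ hab; exact add_right_cancel hab
    rw [e]
    exact sum_le_sum_of_vanish_off _ _ (fun y => ‖w y‖ ^ 2) (fun _ => sq_nonneg _) (fun y hy => by rw [hw y hy, norm_zero]; ring)
  calc ∑ μ, ∑ y ∈ Q, ‖w (y + unitVec μ)‖ ^ 2 ≤ ∑ _μ : Fin d, ∑ y ∈ Q', ‖w y‖ ^ 2 := Finset.sum_le_sum fun μ _ => h μ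
    _ = d * ∑ y ∈ Q', ‖w y‖ ^ 2 := by rw [Finset.sum_const, Finset.card_univ, Fintype.card_fin, nsmul_eq_mul]

/-- **THE FLAT ENERGY IDENTITY** for `w` vanishing off `Q_{r+1}(z)`: `Σ_{Q_{r+2}}⟪w, L^κ w⟫ = Σ_{Q_{r+2}}Σ_μ‖w₊ − w‖² + κΣ_{Q_{r+2}}‖w‖²`.
[folklore] [cite: Giaquinta1984, Ch. III §2 (2.3) p.77] -/
theorem flat_energy_identity (κ : ℝ) (w : Zd d → W) (z : Zd d) (r : ℤ) (hw0 : ∀ y ∉ box z (r + 1), w y = 0) :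
    ∑ y ∈ box z (r + 2), ⟪w y, (∑ μ, ((2 : ℝ) • w y - w (y + unitVec μ) - w (y - unitVec μ))) + κ • w y⟫_ℝ
      = ∑ y ∈ box z (r + 2), ∑ μ, ‖w (y + unitVec μ) - w y‖ ^ 2 + κ * ∑ y ∈ box z (r + 2), ‖w y‖ ^ 2 := by
  have hw0' : ∀ y ∉ box z (r + 2 - 1), w y = 0 := fun y hy => hw0 y (by rwa [show r + 2 - 1 = r + 1 by ring] at hy)
  rw [sum_inner_flatLop κ w w z (r + 2) hw0']
  congr 1
  · exact Finset.sum_congr rfl fun y _ => Finset.sum_congr rfl fun μ _ => real_inner_self_eq_norm_sq _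
  · congr 1; exact Finset.sum_congr rfl fun y _ => real_inner_self_eq_norm_sq _

/-! ## §2 ★★★ The covariant Dirichlet comparison -/

/-- ★★★ **THE COVARIANT DIRICHLET COMPARISON ON A BOX** (the perturbation step of the Campanato road at a curved background, in energy).  Let `d ≥ 1`, `κ > 0`, `r ≥ 0`,
`N := 2r+4`; let `u : ℤ^d → W` solve `L_R^κ u = D*_R g + src` on `Q_{r+1}(z)`; let `‖u‖ ≤ M_u` on `Q_{r+3}(z)`, `‖g(y,μ)‖ ≤ m`, `‖src(y)‖ ≤ σ` and `‖R(y,μ)x − x‖ ≤ δ‖x‖` for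
`y ∈ Q_{r+2}(z)`, with `d·δ²·N² ≤ 1`.  Then `u = h + w` with `w = 0` off `Q_{r+1}(z)`, `L^κ h = 0` (FLAT) on `Q_{r+1}(z)`, and
`Σ_{Q_{r+2}(z)}Σ_μ ‖w(y+e_μ) − w(y)‖² ≤ 5dδ²N²·Σ_{Q_{r+2}(z)}Σ_μ ‖R(y,μ)u(y+e_μ) − u(y)‖² + 5(2r+5)^d·(4dm² + N²σ² + 5dδ²M_u²)`.
PROOF.  `w` = the flat Dirichlet solution of `L^κ w = L^κ u` on `Q_{r+1}` ((C2a) ✓`exists_dirichlet_W`), `h := u − w`; flat energy identity; `L^κ u = L_R^κ u + (L^κ − L_R^κ)u` and the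
equation where `w ≠ 0`; the three pairings of part 1; Poincaré `Σ‖w‖² ≤ N²E` ((C2a) ✓`poincare_zero_ext_W`); `E ≤ √E·X ⟹ E ≤ X² ≤ 5Σx_i²`.
[folklore] [cite: Giaquinta1984, Ch. III §2 Thm 2.2 pp.78–79; Balaban1985BackgroundPropagators, Thm 3.1 (3.43) p.398, (3.35) p.396; Balaban1984PropagatorsII, (1.9) p.226] -/
theorem covariant_dirichlet_comparison [FiniteDimensional ℝ W] (hd : 1 ≤ d) (R : Zd d → Fin d → (W ≃ₗᵢ[ℝ] W)) {κ : ℝ} (hκ : 0 < κ)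
    (u : Zd d → W) (g : Zd d → Fin d → W) (src : Zd d → W) (z : Zd d) {r : ℤ} (hr : 0 ≤ r)
    {Mu m σ δ : ℝ} (hMu : 0 ≤ Mu) (hm : 0 ≤ m) (hσ : 0 ≤ σ) (hδ : 0 ≤ δ)
    (hEq : ∀ y ∈ box z (r + 1),
      (∑ μ, ((2 : ℝ) • u y - R y μ (u (y + unitVec μ)) - (R (y - unitVec μ) μ).symm (u (y - unitVec μ)))) + κ • u y
        = (∑ μ, ((R (y - unitVec μ) μ).symm (g (y - unitVec μ) μ) - g y μ)) + src y)
    (hu : ∀ y ∈ box z (r + 3), ‖u y‖ ≤ Mu)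
    (hg : ∀ y ∈ box z (r + 2), ∀ μ, ‖g y μ‖ ≤ m)
    (hs : ∀ y ∈ box z (r + 2), ‖src y‖ ≤ σ)
    (hR : ∀ y ∈ box z (r + 2), ∀ (μ : Fin d) (x : W), ‖R y μ x - x‖ ≤ δ * ‖x‖)
    (hsmall : (d : ℝ) * δ ^ 2 * ((2 * r + 4 : ℤ) : ℝ) ^ 2 ≤ 1) :
    ∃ h w : Zd d → W, (∀ y, u y = h y + w y) ∧ (∀ y ∉ box z (r + 1), w y = 0) ∧
      (∀ y ∈ box z (r + 1), (∑ μ, ((2 : ℝ) • h y - h (y + unitVec μ) - h (y - unitVec μ))) + κ • h y = 0) ∧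
      ∑ y ∈ box z (r + 2), ∑ μ, ‖w (y + unitVec μ) - w y‖ ^ 2 ≤
        5 * d * δ ^ 2 * ((2 * r + 4 : ℤ) : ℝ) ^ 2 * ∑ y ∈ box z (r + 2), ∑ μ, ‖R y μ (u (y + unitVec μ)) - u y‖ ^ 2
          + 5 * ((2 * (r + 2) + 1 : ℤ) : ℝ) ^ d * (4 * d * m ^ 2 + ((2 * r + 4 : ℤ) : ℝ) ^ 2 * σ ^ 2 + 5 * d * δ ^ 2 * Mu ^ 2) := by
  classical
  -- the flat Dirichlet solution of `L^κ w = L^κ u` on `Q_{r+1}`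
  obtain ⟨w, hw0, hw⟩ := exists_dirichlet_W hκ z (r + 1) (fun y => (∑ μ, ((2 : ℝ) • u y - u (y + unitVec μ) - u (y - unitVec μ))) + κ • u y)
  refine ⟨fun y => u y - w y, w, fun y => (sub_add_cancel (u y) (w y)).symm, hw0, fun y hy => ?_, ?_⟩
  · rw [flatLop_sub, hw y hy, sub_self]
  -- NOTATION
  set N : ℝ := ((2 * r + 4 : ℤ) : ℝ) with hNdef
  set V : ℝ := ((2 * (r + 2) + 1 : ℤ) : ℝ) ^ d with hVdef
  set E : ℝ := ∑ y ∈ box z (r + 2), ∑ μ, ‖w (y + unitVec μ) - w y‖ ^ 2 with hE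
  set P : ℝ := ∑ y ∈ box z (r + 2), ‖w y‖ ^ 2 with hP
  set Φ : ℝ := ∑ y ∈ box z (r + 2), ∑ μ, ‖R y μ (u (y + unitVec μ)) - u y‖ ^ 2 with hΦ
  set ER : ℝ := ∑ y ∈ box z (r + 2), ∑ μ, ‖R y μ (w (y + unitVec μ)) - w y‖ ^ 2 with hER
  set Wp : ℝ := ∑ y ∈ box z (r + 2), ∑ μ, ‖w (y + unitVec μ)‖ ^ 2 with hWp
  have hN0 : 0 ≤ N := by rw [hNdef]; exact_mod_cast (by linarith : (0 : ℤ) ≤ 2 * r + 4)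
  have hV0 : 0 ≤ V := by rw [hVdef]; exact pow_nonneg (by exact_mod_cast (by linarith : (0 : ℤ) ≤ 2 * (r + 2) + 1)) _
  have hE0 : 0 ≤ E := Finset.sum_nonneg fun _ _ => Finset.sum_nonneg fun _ _ => sq_nonneg _
  have hP0 : 0 ≤ P := Finset.sum_nonneg fun _ _ => sq_nonneg _
  have hΦ0 : 0 ≤ Φ := Finset.sum_nonneg fun _ _ => Finset.sum_nonneg fun _ _ => sq_nonneg _
  have hd0 : (0 : ℝ) ≤ d := Nat.cast_nonneg d
  -- Poincaré: `P ≤ N² E` (`w` lives on `Q_{r+1}`)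
  have hPE : P ≤ N ^ 2 * E := by
    have h := poincare_zero_ext_W hd (z := z) (r := r + 1) (by linarith) w hw0
    rw [show r + 1 + 1 = r + 2 by ring] at h
    have e : ((2 * (r + 1) + 2 : ℤ) : ℝ) = N := by rw [hNdef]; push_cast; ring
    rw [e] at h
    have hsub : box z (r + 1) ⊆ box z (r + 2) := box_mono z (by linarith)
    have hPe : P = ∑ y ∈ box z (r + 1), ‖w y‖ ^ 2 := by
      rw [hP]; exact (Finset.sum_subset hsub (fun y _ hy => by rw [hw0 y hy, norm_zero]; ring)).symm
    rw [hPe]; exact h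
  -- translates and covariant energy of `w`
  have hWt : Wp ≤ d * P := sum_translate_sq_le w _ _ (fun y hy => hw0 y fun h => hy (box_mono z (by linarith) h))
  have hERE : ER ≤ 4 * E := by
    have h1 : ER ≤ 2 * E + 2 * (δ ^ 2 * Wp) := cov_energy_le_flat R w _ hR
    have h2 : δ ^ 2 * Wp ≤ E := by
      calc δ ^ 2 * Wp ≤ δ ^ 2 * (d * P) := mul_le_mul_of_nonneg_left hWt (sq_nonneg _)
        _ ≤ δ ^ 2 * (d * (N ^ 2 * E)) := by gcongr
        _ = (d * δ ^ 2 * N ^ 2) * E := by ring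
        _ ≤ 1 * E := mul_le_mul_of_nonneg_right hsmall hE0
        _ = E := one_mul E
    linarith
  -- THE ENERGY IDENTITY `E + κP = Σ⟪w, L^κ u⟫ = (datum) + (source) + (perturbation)`
  have hEnergy : E + κ * P = ∑ y ∈ box z (r + 2), ⟪w y, (∑ μ, ((2 : ℝ) • u y - u (y + unitVec μ) - u (y - unitVec μ))) + κ • u y⟫_ℝ := by
    rw [← flat_energy_identity κ w z r hw0]
    refine Finset.sum_congr rfl fun y _ => ?_
    by_cases hy : y ∈ box z (r + 1)
    · rw [hw y hy]
    · rw [hw0 y hy, inner_zero_left, inner_zero_left]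
  have hw0' : ∀ y ∉ box z (r + 2 - 1), w y = 0 := fun y hy => hw0 y (by rwa [show r + 2 - 1 = r + 1 by ring] at hy)
  have hsplit : ∑ y ∈ box z (r + 2), ⟪w y, (∑ μ, ((2 : ℝ) • u y - u (y + unitVec μ) - u (y - unitVec μ))) + κ • u y⟫_ℝ
      = ∑ y ∈ box z (r + 2), ⟪w y, ∑ μ, ((R (y - unitVec μ) μ).symm (g (y - unitVec μ) μ) - g y μ)⟫_ℝ
        + ∑ y ∈ box z (r + 2), ⟪w y, src y⟫_ℝ
        + ∑ y ∈ box z (r + 2), ∑ μ, (⟪w (y + unitVec μ) - w y, u (y + unitVec μ) - u y⟫_ℝ - ⟪R y μ (w (y + unitVec μ)) - w y, R y μ (u (y + unitVec μ)) - u y⟫_ℝ) := by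
    have h1 : ∑ y ∈ box z (r + 2), ⟪w y, (∑ μ, ((2 : ℝ) • u y - R y μ (u (y + unitVec μ)) - (R (y - unitVec μ) μ).symm (u (y - unitVec μ)))) + κ • u y⟫_ℝ
        = ∑ y ∈ box z (r + 2), ⟪w y, ∑ μ, ((R (y - unitVec μ) μ).symm (g (y - unitVec μ) μ) - g y μ)⟫_ℝ + ∑ y ∈ box z (r + 2), ⟪w y, src y⟫_ℝ := by
      rw [← Finset.sum_add_distrib]
      refine Finset.sum_congr rfl fun y _ => ?_
      by_cases hy : y ∈ box z (r + 1)
      · rw [hEq y hy, inner_add_right]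
      · rw [hw0 y hy, inner_zero_left, inner_zero_left, inner_zero_left, add_zero]
    have h2 := sum_inner_flatLop κ w u z (r + 2) hw0'
    have h3 := sum_inner_covLop R κ w u z (r + 2) hw0'
    have h4 : ∑ y ∈ box z (r + 2), ∑ μ, (⟪w (y + unitVec μ) - w y, u (y + unitVec μ) - u y⟫_ℝ - ⟪R y μ (w (y + unitVec μ)) - w y, R y μ (u (y + unitVec μ)) - u y⟫_ℝ)
        = (∑ y ∈ box z (r + 2), ∑ μ, ⟪w (y + unitVec μ) - w y, u (y + unitVec μ) - u y⟫_ℝ)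
          - ∑ y ∈ box z (r + 2), ∑ μ, ⟪R y μ (w (y + unitVec μ)) - w y, R y μ (u (y + unitVec μ)) - u y⟫_ℝ := by
      rw [← Finset.sum_sub_distrib]; exact Finset.sum_congr rfl fun y _ => Finset.sum_sub_distrib _ _
    linarith
  -- the three pairings
  have hA := pairing_datum_le R w g z hr hw0 hm hg
  have hB := pairing_source_le w src z hr hσ hs
  have hC := pairing_perturbation_le R w u z hr hMu hδ hu hR
  rw [← hER] at hA hC; rw [← hP] at hB; rw [← hWp, ← hΦ] at hC
  -- square roots against `√E`
  have hsqER : Real.sqrt ER ≤ 2 * Real.sqrt E := by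
    rw [show (2 : ℝ) * Real.sqrt E = Real.sqrt (4 * E) by rw [Real.sqrt_mul' _ hE0, show Real.sqrt 4 = 2 by norm_num]]
    exact Real.sqrt_le_sqrt hERE
  have hsqP : Real.sqrt P ≤ N * Real.sqrt E := by
    rw [show N * Real.sqrt E = Real.sqrt (N ^ 2 * E) by rw [Real.sqrt_mul' _ hE0, Real.sqrt_sq hN0]]
    exact Real.sqrt_le_sqrt hPE
  have hsqWp : Real.sqrt Wp ≤ Real.sqrt d * N * Real.sqrt E := by
    have h1 : Real.sqrt Wp ≤ Real.sqrt (d * P) := Real.sqrt_le_sqrt hWt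
    rw [Real.sqrt_mul' _ hP0] at h1
    rw [mul_assoc]
    exact h1.trans (mul_le_mul_of_nonneg_left hsqP (Real.sqrt_nonneg _))
  set x₁ : ℝ := 2 * (m * Real.sqrt (d * V)) with hx₁
  set x₂ : ℝ := N * (σ * Real.sqrt V) with hx₂
  set x₃ : ℝ := 2 * (δ * Mu * Real.sqrt (d * V)) with hx₃
  set x₄ : ℝ := Real.sqrt d * N * (δ * Real.sqrt Φ) with hx₄
  set x₅ : ℝ := Real.sqrt d * N * (δ ^ 2 * Mu * Real.sqrt (d * V)) with hx₅
  have hEX : E ≤ Real.sqrt E * (x₁ + x₂ + x₃ + x₄ + x₅) := by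
    have hκP : 0 ≤ κ * P := mul_nonneg hκ.le hP0
    have h1 : E + κ * P ≤ Real.sqrt ER * (m * Real.sqrt (d * V)) + Real.sqrt P * (σ * Real.sqrt V)
        + (Real.sqrt ER * (δ * Mu * Real.sqrt (d * V)) + Real.sqrt Wp * (δ * Real.sqrt Φ) + Real.sqrt Wp * (δ ^ 2 * Mu * Real.sqrt (d * V))) := by
      rw [hEnergy, hsplit]; exact add_le_add (add_le_add hA hB) hC
    have a1 : Real.sqrt ER * (m * Real.sqrt (d * V)) ≤ 2 * Real.sqrt E * (m * Real.sqrt (d * V)) := mul_le_mul_of_nonneg_right hsqER (by positivity)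
    have a2 : Real.sqrt P * (σ * Real.sqrt V) ≤ N * Real.sqrt E * (σ * Real.sqrt V) := mul_le_mul_of_nonneg_right hsqP (by positivity)
    have a3 : Real.sqrt ER * (δ * Mu * Real.sqrt (d * V)) ≤ 2 * Real.sqrt E * (δ * Mu * Real.sqrt (d * V)) := mul_le_mul_of_nonneg_right hsqER (by positivity)
    have a4 : Real.sqrt Wp * (δ * Real.sqrt Φ) ≤ Real.sqrt d * N * Real.sqrt E * (δ * Real.sqrt Φ) := mul_le_mul_of_nonneg_right hsqWp (by positivity)
    have a5 : Real.sqrt Wp * (δ ^ 2 * Mu * Real.sqrt (d * V)) ≤ Real.sqrt d * N * Real.sqrt E * (δ ^ 2 * Mu * Real.sqrt (d * V)) :=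
      mul_le_mul_of_nonneg_right hsqWp (by positivity)
    have e : 2 * Real.sqrt E * (m * Real.sqrt (d * V)) + N * Real.sqrt E * (σ * Real.sqrt V)
        + (2 * Real.sqrt E * (δ * Mu * Real.sqrt (d * V)) + Real.sqrt d * N * Real.sqrt E * (δ * Real.sqrt Φ) + Real.sqrt d * N * Real.sqrt E * (δ ^ 2 * Mu * Real.sqrt (d * V)))
        = Real.sqrt E * (x₁ + x₂ + x₃ + x₄ + x₅) := by rw [hx₁, hx₂, hx₃, hx₄, hx₅]; ring
    linarith
  -- `E ≤ X²`
  have hEX2 : E ≤ (x₁ + x₂ + x₃ + x₄ + x₅) ^ 2 := by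
    have h1 := two_mul_le_add_sq (Real.sqrt E) (x₁ + x₂ + x₃ + x₄ + x₅)
    rw [Real.sq_sqrt hE0] at h1
    linarith
  -- `X² ≤ 5Σx_i²` and the squares
  have hX2 := sq_le_five x₁ x₂ x₃ x₄ x₅
  have hdV : Real.sqrt (d * V) ^ 2 = d * V := Real.sq_sqrt (by positivity)
  have hVV : Real.sqrt V ^ 2 = V := Real.sq_sqrt hV0
  have hdd : Real.sqrt (d : ℝ) ^ 2 = d := Real.sq_sqrt hd0
  have hΦΦ : Real.sqrt Φ ^ 2 = Φ := Real.sq_sqrt hΦ0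
  have e1 : x₁ ^ 2 = 4 * d * m ^ 2 * V := by rw [hx₁, mul_pow, mul_pow, hdV]; ring
  have e2 : x₂ ^ 2 = N ^ 2 * σ ^ 2 * V := by rw [hx₂, mul_pow, mul_pow, hVV]; ring
  have e3 : x₃ ^ 2 = 4 * d * δ ^ 2 * Mu ^ 2 * V := by rw [hx₃, mul_pow, mul_pow, mul_pow, hdV]; ring
  have e4 : x₄ ^ 2 = d * δ ^ 2 * N ^ 2 * Φ := by rw [hx₄, mul_pow, mul_pow, mul_pow, hdd, hΦΦ]; ring
  have e5 : x₅ ^ 2 = (d * δ ^ 2 * N ^ 2) * (d * δ ^ 2 * Mu ^ 2 * V) := by rw [hx₅, mul_pow, mul_pow, mul_pow, mul_pow, hdd, hdV]; ring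
  have h5 : (d * δ ^ 2 * N ^ 2) * (d * δ ^ 2 * Mu ^ 2 * V) ≤ 1 * (d * δ ^ 2 * Mu ^ 2 * V) := mul_le_mul_of_nonneg_right hsmall (by positivity)
  rw [e1, e2, e3, e4, e5] at hX2
  calc E ≤ (x₁ + x₂ + x₃ + x₄ + x₅) ^ 2 := hEX2
    _ ≤ 5 * (4 * d * m ^ 2 * V + N ^ 2 * σ ^ 2 * V + 4 * d * δ ^ 2 * Mu ^ 2 * V + d * δ ^ 2 * N ^ 2 * Φ + 1 * (d * δ ^ 2 * Mu ^ 2 * V)) := by linarith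
    _ = 5 * d * δ ^ 2 * N ^ 2 * Φ + 5 * V * (4 * d * m ^ 2 + N ^ 2 * σ ^ 2 + 5 * d * δ ^ 2 * Mu ^ 2) := by ring

end Summit.QuantumFields.YangMills.Theorems.Prop7CovariantDirichletComparison

end
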